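import Summits.HodgeConjecture.HodgeConjecture.Theorems.MarkmanPartnerTransportPartnerExistenceLattice
import Summits.HodgeConjecture.HodgeConjecture.Theorems.MarkmanPartnerTransportPicardThreeK3SquaresKugaSatakeSelfDescent
import Literature.AlgebraicGeometry.Hyperkaehler.KugaSatakeCorrespondenceHyperkaehler
import Literature.AlgebraicGeometry.Motives.HodgeStructureK3TranscendentalOrthogonal
import Summits.HodgeConjecture.HodgeConjecture.Theorems.NikulinTwinTransportTwinSimilitudeAlgebraicStubHkLatticeWittAux

/-!
# Route MarkmanPartnerTransport · crux `LowPicardRealMultiplication` (stmt-HodgeConjecture-19653) —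
# the rational Hodge structure `H²_B(X)` of a MARKED `K3^{[2]}`-type fourfold: rational Beauville–Bogomolov
# form, K3 type, Hodge–Riemann input for the transcendental part

First half of the `K3^{[2]}`-side twin of gen 14's `…PicardThreeK3SquaresTranscendentalPresentation` (which
inhabited the `∀ (T, H, P, ε, j)` binder of the SURFACE Kuga–Satake predicate). For a smooth projective
fourfold `X` with a marking `(φ, P, z)` (clauses (m1)–(m6) of the route's `MarkedK3Sq`) and the real Hodge
model, on the weight-two `ℚ`-Hodge structure `H²_B(X)` (`Hyperkaehler.bettiTwoHodgeStructureOfModel`):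

* `exists_ratBBF` — **a RATIONAL Beauville–Bogomolov form** `q_B : H²(X(ℂ); ℚ) × H²(X(ℂ); ℚ) → ℚ`,
  symmetric and non-degenerate, with `q_B(a, b) ⊗ 1 = q(φ(a ⊗ 1), φ(b ⊗ 1))` (rational classes are `φ⁻¹(ℚ²³)`
  under the integral marking, `PartnerLattice.isRationalClass_iff_of_markedSq`);
* `ratBBF_baseChange` — `(q_B)_ℂ(x, y) = q(φ Θx, φ Θy)`;
* `mem_pieceHK_iff_isOfHodgeType` — pieces of `H²_B(X)` are the Hodge types read through `Θ`;
* `isOfK3Type_bettiTwoHK` — **`H²_B(X)` is of K3 type** (`V^{2,0} = ℂ · Θ⁻¹(φ⁻¹z)` by (m4); no far types);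
* `ratBBF_F_apply_eq_zero` — **first Hodge–Riemann relation** `(q_B)_ℂ(F^p, F^{3−p}) = 0` (from (m4),
  (m5) `H^{1,1} ⊥ z`, (m6) `q(z, z) = 0`);
* `ratBBF_twoZero_conj_ne_zero` — `(q_B)_ℂ(x, x̄) ≠ 0` on `V^{2,0} ∖ 0` (`q(z̄, z) > 0`, (m6); markings are
  real, `BBFPositivity.marking_conjClass`);
* `exists_transcendental_subHodgeStructureHK` — **`T(X)_ℚ := Hdg¹(X)^{⊥ q_B}` underlies THE TRANSCENDENTAL PART
  of `H²_B(X)` (Huybrechts Def. 2.5 / Lemma 3.1), an IRREDUCIBLE polarizable sub-Hodge structure of K3 type**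
  (the tree's abstract `exists_isTranscendentalPart_orthogonal_hodgeClasses` +
  `Huybrechts_transcendentalPart_irreducible_holds`).

The sequel (`…K3Sq2TranscendentalPresentationHK`) polarizes `T(X)_ℚ` by `−q_B` (Hodge index via
`…PartnerExistenceBBFPositivity`) and inhabits `IsTranscendentalPartHK`. THEOREMS ONLY; no definition,
no named fact, no sorry; nothing here says HC or any crux is proved. Prover seat hodge-nonav-19652-p1
(gen 15), `--supports stmt-HodgeConjecture-19653`.

References: A. Beauville, J. Differential Geom. 18 (1983) §8; D. Huybrechts, *Lectures on K3 Surfaces*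
Ch. 3 Def. 2.5, Lemma 2.7, Lemma 3.1; C. Voisin, *Hodge Theory I* §7.1; M. Varesco, Math. Z. 305 (2023) §4.
-/

set_option linter.dupNamespace false

noncomputable section

namespace Summit.HodgeConjecture.HodgeConjecture.Theorems.MarkmanPartnerTransport.KugaSatakeHK

open scoped TensorProduct
open CategoryTheory Literature.AlgebraicGeometry Literature.AlgebraicGeometry.Motives
open Literature.AlgebraicGeometry.HodgeTheory Literature.AlgebraicTopology.SingularHomology
open Literature.AlgebraicGeometry.Motives.HodgeStructure Literature.AlgebraicGeometry.Hyperkaehler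
open Literature.AlgebraicGeometry.Surfaces
open Summit.HodgeConjecture.HodgeConjecture.Theorems.NikulinTwinTransport
open Summit.HodgeConjecture.HodgeConjecture.Theorems.MarkmanPartnerTransport.BBFPositivity
open Summit.HodgeConjecture.HodgeConjecture.Theorems.MarkmanPartnerTransport.PartnerLattice

variable {X : SchemeOver ℂ} {φ : complexBetti X 2 ≃ₗ[ℂ] (K3HilbertIndex → ℂ)} {P : complexBetti X (2 * 4)}
  {z : K3HilbertIndex → ℂ}

/-- `MarkedK3Sq[X, φ, P, z]`: VERBATIM the `let MarkedK3Sq := …` binder of the route declarations of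
MarkmanPartnerTransport (clauses (m1)–(m6)). Local notation only. -/
local notation3 (prettyPrint := false) "MarkedK3Sq[" X ", " φ ", " P ", " z "]" =>
  (((IsIntegralClass P ∧ ∀ Q : complexBetti X (2 * 4), IsIntegralClass Q → ∃ n : ℤ, Q = n • P) ∧
    (∀ c : complexBetti X 2, IsIntegralClass c ↔ ∃ v : K3HilbertIndex → ℤ, φ c = fun i => (v i : ℂ)) ∧
    (∀ a : complexBetti X 2, cupPowTwo a 4 = ((3 : ℂ) * (k3HilbertForm 2 (φ a) (φ a)) ^ 2) • P) ∧
    (IsOfHodgeType 4 X 2 2 0 (LinearEquiv.symm φ z) ∧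
      ∀ τ : complexBetti X 2, IsOfHodgeType 4 X 2 2 0 τ → ∃ t : ℂ, τ = t • LinearEquiv.symm φ z) ∧
    (∀ c : complexBetti X 2, IsOfHodgeType 4 X 2 1 1 c ↔
      (k3HilbertForm 2 (φ c) z = 0 ∧ k3HilbertForm 2 (φ c) (star z) = 0)) ∧
    (k3HilbertForm 2 z z = 0 ∧ 0 < (k3HilbertForm 2 (star z) z).re)))

/-- `qQ` = the rational Beauville–Bogomolov form of `K3^{[2]}`-type on `ℚ²³`. Local notation only. -/
local notation3 (prettyPrint := false) "qQ" => Matrix.toBilin' (Matrix.map (k3HilbertGram 2) (Int.cast : ℤ → ℚ))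

/-- `qC` = the complex Beauville–Bogomolov form on `ℂ²³`. Local notation only. -/
local notation3 (prettyPrint := false) "qC" => Matrix.toBilin' (Matrix.map (k3HilbertGram 2) (Int.cast : ℤ → ℂ))

/-- `H²_B[hX]`: the weight-two `ℚ`-Hodge structure on `H²(X(ℂ); ℚ)` of the real Hodge model of the fourfold
`X` (`hX : IsSmoothProjective (2 * 2) X`). Local notation only. -/
local notation3 "H²_B[" hX "]" =>
  bettiTwoHodgeStructureOfModel hX (BettiUniverse.realHodgeModel exists_isReal_hodgeModel_holds hX)
    (BettiUniverse.realHodgeModel_isHodgeSymmetric exists_isReal_hodgeModel_holds hX)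

/-- `Θ : ℂ ⊗_ℚ H²(X(ℂ); ℚ) → H²(X(ℂ); ℂ)`. -/
local notation3 "Θ[" X "]" => ofRatClassBaseChange (Motives.ComplexPoints X) (2 * 1)

/-- `ι : H²(X(ℂ); ℚ) → H²(X(ℂ); ℂ)`, the rational lattice. -/
local notation3 "ι[" X "]" => ofRatClass (Motives.ComplexPoints X) (2 * 1)

/-! ### §0 Bilinearity of the `K3^{[2]}` form (through the Mathlib bilinear form `qC`) -/

/-- Additivity of `q` in the first slot. [folklore] -/
theorem bbf_add_left (u u' v : K3HilbertIndex → ℂ) :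
    k3HilbertForm 2 (u + u') v = k3HilbertForm 2 u v + k3HilbertForm 2 u' v := by
  rw [← qC_apply, LinearMap.map_add₂, qC_apply, qC_apply]

/-- Additivity of `q` in the second slot. [folklore] -/
theorem bbf_add_right (u v v' : K3HilbertIndex → ℂ) :
    k3HilbertForm 2 u (v + v') = k3HilbertForm 2 u v + k3HilbertForm 2 u v' := by
  rw [← qC_apply, map_add, qC_apply, qC_apply]

/-- Homogeneity of `q` in the second slot. [folklore] -/
theorem bbf_smul_right (c : ℂ) (u v : K3HilbertIndex → ℂ) :
    k3HilbertForm 2 u (c • v) = c * k3HilbertForm 2 u v := by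
  rw [← qC_apply, map_smul, smul_eq_mul, qC_apply]

/-- `q(0, v) = 0`. [folklore] -/
theorem bbf_zero_left (v : K3HilbertIndex → ℂ) : k3HilbertForm 2 0 v = 0 := by rw [← qC_apply, LinearMap.map_zero₂]

/-- `q(u, 0) = 0`. [folklore] -/
theorem bbf_zero_right (u : K3HilbertIndex → ℂ) : k3HilbertForm 2 u 0 = 0 := by rw [← qC_apply, map_zero]

/-! ### §1 The rational Beauville–Bogomolov form -/

/-- **The Beauville–Bogomolov form of a marked `X` is defined over `ℚ` on `H²(X(ℂ); ℚ)`**: there is a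
symmetric, non-degenerate `ℚ`-bilinear form `q_B` with `q_B(a, b) ⊗ 1 = q(φ(a ⊗ 1), φ(b ⊗ 1))` (rational
classes have rational coordinates under the integral marking; `q` has an integral Gram matrix of determinant
`2`). [cite: Beauville1983, §8 Thm. 5] [cite: VoisinHodgeI2002, §7.1.1] -/
theorem exists_ratBBF (hX : IsSmoothProjective 4 X)
    (hint : ∀ c : complexBetti X 2, IsIntegralClass c ↔ ∃ v : K3HilbertIndex → ℤ, φ c = fun i => (v i : ℂ)) :
    ∃ qB : LinearMap.BilinForm ℚ (bettiCohomology X (2 * 1)), qB.IsSymm ∧ qB.Nondegenerate ∧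
      ∀ a b, ((qB a b : ℚ) : ℂ) = k3HilbertForm 2 (φ (ι[X] a)) (φ (ι[X] b)) := by
  classical
  -- rational coordinates of rational classes
  have hex : ∀ a : bettiCohomology X (2 * 1), ∃ w : K3HilbertIndex → ℚ, φ (ι[X] a) = fun i => (w i : ℂ) :=
    fun a => (isRationalClass_iff_of_markedSq hX hint _).1 (isRationalClass_ofRatClass _)
  choose κ hκ using hex
  have hκlin_add : ∀ a b, κ (a + b) = κ a + κ b := fun a b => by
    apply ratCastVec_injective
    rw [← hκ]
    funext i
    rw [map_add, map_add, hκ, hκ]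
    simp
  have hκlin_smul : ∀ (c : ℚ) a, κ (c • a) = c • κ a := fun c a => by
    apply ratCastVec_injective
    rw [← hκ]
    funext i
    rw [ofRatClass_smul, map_smul, hκ]
    simp
  let K : bettiCohomology X (2 * 1) →ₗ[ℚ] (K3HilbertIndex → ℚ) :=
    { toFun := κ, map_add' := hκlin_add, map_smul' := hκlin_smul }
  have hK : ∀ a, φ (ι[X] a) = fun i => ((K a) i : ℂ) := hκ
  have hKinj : Function.Injective K := by
    intro a b h
    apply ofRatClass_injective (Y := Motives.ComplexPoints X) (2 * 1)
    apply φ.injective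
    rw [hK, hK]
    exact congrArg (fun w : K3HilbertIndex → ℚ => fun i => ((w i : ℚ) : ℂ)) h
  have hsymm : ∀ a b, (qQ).compl₁₂ K K a b = (qQ).compl₁₂ K K b a := fun a b => by
    simp only [LinearMap.compl₁₂_apply]
    exact qQ_comm _ _
  -- non-degenerate: through `ℚ²³` the rational classes span `ℂ²³`
  have hleft : ∀ a, (∀ b, (qQ).compl₁₂ K K a b = 0) → a = 0 := by
    intro a ha
    apply hKinj
    rw [map_zero]
    have hzero : ∀ y : complexBetti X 2, k3HilbertForm 2 (φ (ι[X] a)) (φ y) = 0 := by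
      intro y
      obtain ⟨u, rfl⟩ := ofRatClassBaseChange_surjective hX (2 * 1) y
      induction u using TensorProduct.induction_on with
      | zero => rw [map_zero, map_zero, bbf_zero_right]
      | tmul c b =>
        rw [ofRatClassBaseChange_tmul, map_smul, bbf_smul_right, hK a, hK b, k3HilbertForm_ratCast]
        have h0 : qQ (K a) (K b) = 0 := by
          have h := ha b
          rwa [LinearMap.compl₁₂_apply] at h
        rw [show (Matrix.toBilin' ((k3HilbertGram 2).map (Int.cast : ℤ → ℚ))) (K a) (K b) = 0 from h0]
        simp
      | add u v hu hv => rw [map_add, map_add, bbf_add_right, hu, hv, add_zero]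
    have h1 : φ (ι[X] a) = 0 := by
      refine qC_nondegenerate.1 _ fun w => ?_
      rw [qC_apply, ← φ.apply_symm_apply w]
      exact hzero _
    apply ratCastVec_injective
    rw [← hK, h1]
    funext i; simp
  refine ⟨(qQ).compl₁₂ K K, ⟨fun a b => hsymm a b⟩, ⟨fun a ha => hleft a ha, fun a ha => hleft a fun b => ?_⟩,
    fun a b => ?_⟩
  · rw [hsymm]; exact ha b
  · simp only [LinearMap.compl₁₂_apply]
    rw [hK a, hK b, k3HilbertForm_ratCast]

/-- **`(q_B)_ℂ(x, y) = q(φ Θx, φ Θy)`**: the base change of the rational form is the complex form through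
`Θ`. [cite: VoisinHodgeI2002, §7.1.1] -/
theorem ratBBF_baseChange {qB : LinearMap.BilinForm ℚ (bettiCohomology X (2 * 1))}
    (hqB : ∀ a b, ((qB a b : ℚ) : ℂ) = k3HilbertForm 2 (φ (ι[X] a)) (φ (ι[X] b)))
    (x y : ℂ ⊗[ℚ] bettiCohomology X (2 * 1)) :
    qB.baseChange ℂ x y = k3HilbertForm 2 (φ (Θ[X] x)) (φ (Θ[X] y)) := by
  induction x using TensorProduct.induction_on generalizing y with
  | zero => rw [LinearMap.map_zero₂, map_zero, map_zero, bbf_zero_left]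
  | tmul a v =>
    induction y using TensorProduct.induction_on with
    | zero => rw [map_zero, map_zero, map_zero, bbf_zero_right]
    | tmul b w =>
      rw [LinearMap.BilinForm.baseChange_tmul, ofRatClassBaseChange_tmul, ofRatClassBaseChange_tmul, map_smul,
        map_smul, HkLatticeWitt.k3HilbertForm_smul_left, bbf_smul_right, ← hqB]
      simp only [Algebra.smul_def, eq_ratCast]
      ring
    | add y₁ y₂ h₁ h₂ => rw [map_add, map_add, map_add, bbf_add_right, h₁, h₂]
  | add x₁ x₂ h₁ h₂ =>
    rw [LinearMap.map_add₂, h₁, h₂, map_add, map_add, bbf_add_left]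

/-! ### §2 Hodge types of `H²_B(X)` -/

/-- Membership in a Hodge piece of `H²_B(X)` read on `H²(X(ℂ); ℂ)` through `Θ`. [cite: VoisinHodgeI2002, §7.1.1] -/
theorem mem_pieceHK_iff_isOfHodgeType (hX : IsSmoothProjective (2 * 2) X) {p q : ℕ} (hpq : p + q = 2)
    (x : ℂ ⊗[ℚ] bettiCohomology X (2 * 1)) :
    x ∈ (H²_B[hX]).piece p q ↔ IsOfHodgeType 4 X (2 * 1) p q (Θ[X] x) := by
  have h := BettiUniverse.mem_hodge_piece_iff exists_isReal_hodgeModel_holds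
    hodgePQ_independent_of_hodgeModel_holds hX (k := 2 * 1) (p := p) (q := q) (by omega) x
  rw [bettiTwoHodgeStructureOfModel, cast_piece]
  exact_mod_cast h

/-- The piece `V^{2,0}` of `H²_B(X)` read through `Θ`. [cite: VoisinHodgeI2002, §7.1.1] -/
theorem mem_pieceHK_two_zero_iff (hX : IsSmoothProjective (2 * 2) X) (x : ℂ ⊗[ℚ] bettiCohomology X (2 * 1)) :
    x ∈ (H²_B[hX]).piece 2 0 ↔ IsOfHodgeType 4 X (2 * 1) 2 0 (Θ[X] x) := by
  exact_mod_cast mem_pieceHK_iff_isOfHodgeType hX (p := 2) (q := 0) rfl x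

/-- The piece `V^{1,1}` of `H²_B(X)` read through `Θ`. [cite: VoisinHodgeI2002, §7.1.1] -/
theorem mem_pieceHK_one_one_iff (hX : IsSmoothProjective (2 * 2) X) (x : ℂ ⊗[ℚ] bettiCohomology X (2 * 1)) :
    x ∈ (H²_B[hX]).piece 1 1 ↔ IsOfHodgeType 4 X (2 * 1) 1 1 (Θ[X] x) := by
  exact_mod_cast mem_pieceHK_iff_isOfHodgeType hX (p := 1) (q := 1) rfl x

/-- The piece `V^{0,2}` of `H²_B(X)` read through `Θ`. [cite: VoisinHodgeI2002, §7.1.1] -/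
theorem mem_pieceHK_zero_two_iff (hX : IsSmoothProjective (2 * 2) X) (x : ℂ ⊗[ℚ] bettiCohomology X (2 * 1)) :
    x ∈ (H²_B[hX]).piece 0 2 ↔ IsOfHodgeType 4 X (2 * 1) 0 2 (Θ[X] x) := by
  exact_mod_cast mem_pieceHK_iff_isOfHodgeType hX (p := 0) (q := 2) rfl x

/-- `Θ(conj x) = conjClass (Θ x)` (through the real Hodge model). [cite: VoisinHodgeI2002, Cor. 6.12] -/
theorem ofRatClassBaseChange_conj_eq₄ (hX : IsSmoothProjective (2 * 2) X) (x : ℂ ⊗[ℚ] bettiCohomology X (2 * 1)) :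
    Θ[X] (HodgeStructure.conj x) = conjClass _ (2 * 1) (Θ[X] x) :=
  KaehlerRationalDatum.ofRatClassBaseChange_conj hX (BettiUniverse.realHodgeModel exists_isReal_hodgeModel_holds hX) x

/-- **`H²_B(X)` is of K3 type** for a marked `X`: `V^{2,0} = ℂ · Θ⁻¹(φ⁻¹ z)` ((m4): `φ⁻¹ z ≠ 0` spans the
`(2,0)`-classes) and `V^{p,q} = 0` for `|p − q| > 2` (no Hodge type of `H²` has an entry `> 2`).
[cite: Huybrechts2016K3, Ch. 3 Def. 2.3] [cite: VoisinHodgeI2002, §6.1.3] -/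
theorem isOfK3Type_bettiTwoHK (hX : IsSmoothProjective (2 * 2) X) (hM : MarkedK3Sq[X, φ, P, z]) :
    (H²_B[hX]).IsOfK3Type := by
  obtain ⟨-, -, -, ⟨h20, hline⟩, -, hzz, hzpos⟩ := hM
  have hσ0 : LinearEquiv.symm φ z ≠ 0 := by
    intro h0
    have hz : z = 0 := by simpa using congrArg φ h0
    rw [hz] at hzpos
    simp [k3HilbertForm] at hzpos
  constructor
  · obtain ⟨t, ht⟩ := ofRatClassBaseChange_surjective hX (2 * 1) (LinearEquiv.symm φ z)
    have htmem : t ∈ (H²_B[hX]).piece 2 0 := by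
      rw [mem_pieceHK_two_zero_iff hX, ht]; exact h20
    have ht0 : t ≠ 0 := by rintro rfl; exact hσ0 (by rw [← ht, map_zero])
    have hspan : (H²_B[hX]).piece 2 0 = ℂ ∙ t := by
      refine le_antisymm (fun x hx ↦ ?_) ((Submodule.span_singleton_le_iff_mem _ _).2 htmem)
      rw [mem_pieceHK_two_zero_iff hX] at hx
      obtain ⟨c, hc⟩ := hline _ hx
      rw [Submodule.mem_span_singleton]
      refine ⟨c, ofRatClassBaseChange_injective _ _ ?_⟩
      rw [map_smul, ht, ← hc]
    show Module.finrank ℂ ((H²_B[hX]).piece 2 0) = 1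
    rw [hspan, finrank_span_singleton ht0]
  · intro p q hpq
    by_cases hsum : p + q = 2
    · have hF : ∀ r : ℤ, 2 < r → (H²_B[hX]).F r = ⊥ := fun r hr ↦ by
        show (BettiUniverse.hodge exists_isReal_hodgeModel_holds hX (2 * 1)).F r = ⊥
        rw [BettiUniverse.hodge_F]
        exact HodgeModel.ratF_eq_bot _ hX (2 * 1) (by push_cast; omega)
      rcases lt_or_ge 2 p with hp | hp
      · exact eq_bot_iff.2 ((HodgeStructure.piece_le_F _ p q).trans (hF p hp).le)
      · have hq : 2 < q := by
          rcases le_or_gt 0 (p - q) with h | h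
          · rw [abs_of_nonneg h] at hpq; omega
          · rw [abs_of_neg h] at hpq; omega
        refine eq_bot_iff.2 ((HodgeStructure.piece_le_complexConj_F _ p q).trans ?_)
        rw [hF q hq, HodgeStructure.complexConj_bot]
    · exact HodgeStructure.piece_eq_bot_of_add_ne _ hsum

/-- `H²_B(X)` is polarizable (the tree's theorem `smoothProjective_hodgeStructure_isPolarizable_holds`).
[cite: VoisinHodgeI2002, Thm. 6.32 with §7.1.2] -/
theorem isPolarizable_bettiTwoHK (hX : IsSmoothProjective (2 * 2) X) : (H²_B[hX]).IsPolarizable :=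
  (smoothProjective_hodgeStructure_isPolarizable_holds hX _ _ (2 * 1)).cast _

/-! ### §3 The two Hodge–Riemann inputs for the transcendental part -/

/-- A class of the rational filtration step `F^r H²_B(X)` complexifies to a sum of classes of types `(a, 2−a)`,
`a ≥ r`; we only need its `q`-pairings with `z`: **for `x ∈ F^p` and `y ∈ F^{3−p}`, `q(φΘx, φΘy) = 0`**
(the pairs of types occurring are `(2,0)·(2,0)`, `(2,0)·(1,1)` and their swaps; `q(z, z) = 0` by (m6) and
`H^{1,1} ⊥ z` by (m5)). [cite: VoisinHodgeI2002, §7.1.2 and Lemma 7.30] [cite: Beauville1983, §8] -/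
theorem ratBBF_F_apply_eq_zero (hX : IsSmoothProjective (2 * 2) X) (hM : MarkedK3Sq[X, φ, P, z])
    {qB : LinearMap.BilinForm ℚ (bettiCohomology X (2 * 1))}
    (hqB : ∀ a b, ((qB a b : ℚ) : ℂ) = k3HilbertForm 2 (φ (ι[X] a)) (φ (ι[X] b)))
    (p : ℤ) (x : ℂ ⊗[ℚ] bettiCohomology X (2 * 1)) (hx : x ∈ (H²_B[hX]).F p)
    (y : ℂ ⊗[ℚ] bettiCohomology X (2 * 1)) (hy : y ∈ (H²_B[hX]).F (3 - p)) :
    qB.baseChange ℂ x y = 0 := by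
  obtain ⟨-, -, -, ⟨h20, hline⟩, h11, hzz, -⟩ := hM
  set A := BettiUniverse.realHodgeModel exists_isReal_hodgeModel_holds hX with hA
  -- the `q`-pairing of two classes of types `(a, 2-a)`, `(a', 2-a')` with `a + a' ≥ 3` vanishes
  have key : ∀ (a a' : ℕ) (u v : complexBetti X 2), a + a' ≥ 3 → a ≤ 2 → a' ≤ 2 →
      IsOfHodgeType 4 X 2 a (2 - a) u → IsOfHodgeType 4 X 2 a' (2 - a') v →
      k3HilbertForm 2 (φ u) (φ v) = 0 := by
    intro a a' u v haa ha ha' hu hv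
    have htwo : ∀ w : complexBetti X 2, IsOfHodgeType 4 X 2 2 0 w →
        ∀ w' : complexBetti X 2, (IsOfHodgeType 4 X 2 2 0 w' ∨ IsOfHodgeType 4 X 2 1 1 w') →
        k3HilbertForm 2 (φ w) (φ w') = 0 := by
      intro w hw w' hw'
      obtain ⟨t, rfl⟩ := hline w hw
      rw [map_smul, LinearEquiv.apply_symm_apply, HkLatticeWitt.k3HilbertForm_smul_left]
      rcases hw' with hw' | hw'
      · obtain ⟨t', rfl⟩ := hline w' hw'
        rw [map_smul, LinearEquiv.apply_symm_apply, bbf_smul_right, hzz, mul_zero, mul_zero]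
      · rw [k3HilbertForm_comm, ((h11 w').1 hw').1, mul_zero]
    interval_cases a
    · omega
    · interval_cases a'
      · omega
      · omega
      · rw [k3HilbertForm_comm]; exact htwo v hv u (Or.inr hu)
    · interval_cases a'
      · omega
      · exact htwo u hu v (Or.inr hv)
      · exact htwo u hu v (Or.inl hv)
  -- expand `x ∈ F^p`, `y ∈ F^{3-p}` along the rational pieces
  have hF : ∀ r : ℤ, (H²_B[hX]).F r = A.ratF hX (2 * 1) r := fun r => rfl
  rw [hF, HodgeModel.ratF_eq_iSup] at hx
  rw [hF, HodgeModel.ratF_eq_iSup] at hy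
  rw [ratBBF_baseChange hqB]
  induction hx using Submodule.iSup_induction' with
  | mem pq x hx =>
    by_cases hr : p ≤ (pq.1.1 : ℤ)
    · rw [iSup_pos hr, HodgeModel.mem_ratPiece_iff, HodgeModel.complexification_apply] at hx
      have hxt : IsOfHodgeType 4 X 2 pq.1.1 pq.1.2 (Θ[X] x) := ⟨A, hx⟩
      have hab : pq.1.1 + pq.1.2 = 2 * 1 := Finset.HasAntidiagonal.mem_antidiagonal.1 pq.2
      induction hy using Submodule.iSup_induction' with
      | mem pq' y hy =>
        by_cases hr' : 3 - p ≤ (pq'.1.1 : ℤ)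
        · rw [iSup_pos hr', HodgeModel.mem_ratPiece_iff, HodgeModel.complexification_apply] at hy
          have hyt : IsOfHodgeType 4 X 2 pq'.1.1 pq'.1.2 (Θ[X] y) := ⟨A, hy⟩
          have hab' : pq'.1.1 + pq'.1.2 = 2 * 1 := Finset.HasAntidiagonal.mem_antidiagonal.1 pq'.2
          have h2 : pq.1.2 = 2 - pq.1.1 := by omega
          have h2' : pq'.1.2 = 2 - pq'.1.1 := by omega
          rw [h2] at hxt
          rw [h2'] at hyt
          exact key _ _ _ _ (by omega) (by omega) (by omega) hxt hyt
        · rw [iSup_neg hr', Submodule.mem_bot] at hy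
          rw [hy, map_zero, map_zero, bbf_zero_right]
      | zero => rw [map_zero, map_zero, bbf_zero_right]
      | add y₁ y₂ _ _ h₁ h₂ => rw [map_add, map_add, bbf_add_right, h₁, h₂, add_zero]
    · rw [iSup_neg hr, Submodule.mem_bot] at hx
      rw [hx, map_zero, map_zero, bbf_zero_left]
  | zero => rw [map_zero, map_zero, bbf_zero_left]
  | add x₁ x₂ _ _ h₁ h₂ => rw [map_add, map_add, bbf_add_left, h₁, h₂, add_zero]

/-- **`(q_B)_ℂ(x, x̄) ≠ 0` for `0 ≠ x ∈ V^{2,0}`**: `Θx = t · φ⁻¹z` with `t ≠ 0`, the marking is real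
(`φ(c̄) = \overline{φ c}`), so the value is `t t̄ · q(z, z̄) ≠ 0` by (m6).
[cite: Huybrechts2016K3, Ch. 6 Prop. 1.2] [cite: VoisinHodgeI2002, §6.3.2] -/
theorem ratBBF_twoZero_conj_ne_zero (hX : IsSmoothProjective (2 * 2) X) (hM : MarkedK3Sq[X, φ, P, z])
    {qB : LinearMap.BilinForm ℚ (bettiCohomology X (2 * 1))}
    (hqB : ∀ a b, ((qB a b : ℚ) : ℂ) = k3HilbertForm 2 (φ (ι[X] a)) (φ (ι[X] b)))
    (x : ℂ ⊗[ℚ] bettiCohomology X (2 * 1)) (hx : x ∈ (H²_B[hX]).piece 2 0) (h0 : x ≠ 0) :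
    qB.baseChange ℂ x (HodgeStructure.conj x) ≠ 0 := by
  obtain ⟨-, hint, -, ⟨h20, hline⟩, -, hzz, hzpos⟩ := hM
  rw [mem_pieceHK_two_zero_iff hX] at hx
  obtain ⟨t, ht⟩ := hline _ hx
  have ht0 : t ≠ 0 := by
    rintro rfl
    rw [zero_smul] at ht
    exact h0 (ofRatClassBaseChange_injective _ _ (by rw [ht, map_zero]))
  rw [ratBBF_baseChange hqB, ofRatClassBaseChange_conj_eq₄ hX, ht, conjClass_smul, map_smul, map_smul,
    marking_conjClass hint, LinearEquiv.apply_symm_apply, HkLatticeWitt.k3HilbertForm_smul_left, bbf_smul_right, k3HilbertForm_comm]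
  have hr : k3HilbertForm 2 (star z) z ≠ 0 := fun h => by rw [h] at hzpos; simp at hzpos
  exact mul_ne_zero ht0 (mul_ne_zero ((map_ne_zero_iff _ (RingHom.injective _)).2 ht0) hr)

/-! ### §4 The transcendental part of `H²_B(X)` -/

/-- **The transcendental lattice `T(X)_ℚ = Hdg¹(X)^{⊥ q_B}` underlies THE transcendental part of `H²_B(X)`,
an IRREDUCIBLE polarizable sub-Hodge structure of K3 type** (Huybrechts Ch. 3 Def. 2.5 / Lemma 3.1 with
Lemma 2.7, the tree's abstract `exists_isTranscendentalPart_orthogonal_hodgeClasses` and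
`Huybrechts_transcendentalPart_irreducible_holds` fed the rational Beauville–Bogomolov form). Stated with the
form as data: some symmetric non-degenerate `q_B` computing `q ∘ (φ × φ)` on rational classes and some
sub-Hodge structure `T` with `T = Hdg¹^{⊥ q_B}`. [cite: Huybrechts2016K3, Ch. 3 Def. 2.5, Lemma 2.7 and Lemma 3.1] -/
theorem exists_transcendental_subHodgeStructureHK (hX : IsSmoothProjective (2 * 2) X) (hM : MarkedK3Sq[X, φ, P, z]) :
    ∃ (qB : LinearMap.BilinForm ℚ (bettiCohomology X (2 * 1))) (T : SubHodgeStructure (H²_B[hX])),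
      qB.IsSymm ∧ qB.Nondegenerate ∧ (∀ a b, ((qB a b : ℚ) : ℂ) = k3HilbertForm 2 (φ (ι[X] a)) (φ (ι[X] b))) ∧
      T.toSubmodule = qB.orthogonal ((H²_B[hX]).hodgeClasses 1) ∧ (H²_B[hX]).IsTranscendentalPart T ∧
      T.toHodgeStructure.IsIrreducible ∧ T.toHodgeStructure.IsOfK3Type ∧ T.toHodgeStructure.IsPolarizable := by
  haveI : Module.Finite ℚ (bettiCohomology X (2 * 1)) := BettiUniverse.finite hX (2 * 1)
  obtain ⟨-, hint, -⟩ := id hM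
  obtain ⟨qB, hsymm, hnd, hqB⟩ := exists_ratBBF hX hint
  have hK3 := isOfK3Type_bettiTwoHK hX hM
  obtain ⟨T, hT, htr⟩ := exists_isTranscendentalPart_orthogonal_hodgeClasses hK3 qB hsymm hnd
    (ratBBF_F_apply_eq_zero hX hM hqB) (ratBBF_twoZero_conj_ne_zero hX hM hqB)
  exact ⟨qB, T, hsymm, hnd, hqB, hT, htr,
    Huybrechts_transcendentalPart_irreducible_holds _ hK3 (isPolarizable_bettiTwoHK hX) T htr⟩

end Summit.HodgeConjecture.HodgeConjecture.Theorems.MarkmanPartnerTransport.KugaSatakeHK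

end
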